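import Mathlib
import HarnessLib
import Summits.BirchSwinnertonDyer.BirchSwinnertonDyer.Theorems.SmallImageMuTransferMuTransferStubX9GraphPairing

/-!
# Brick S3 of `stub_depthX9` (line `graded_euler_loss`, crux `KatoDivisibilityX9` = stmt-BirchSwinnertonDyer-20547):
# KOLY Lemma 5.7.B / MU-TRANSFER-PROOF §4 Lemma 4 **with defect `c`** — the graph pairing has `T`-valuation
# `≤ c + 1` when the second projection of the Goursat module only contains `T^c · 𝒯_e^*`

Seat `bsd-line-k6-p4` (prover-bsd-line-k6-p4-g3-0; D-0154 KEY (146) row 9; route `OneSidedTwistSqueezeX9`; host cell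
`bsd-f3-mu`).  THEOREMS ONLY, sorry-free: pure linear algebra over a field with `2 ≠ 0`; no definition, no named
fact, nothing asserted about any curve.  `--supports stmt-BirchSwinnertonDyer-20547`.  This is the cell's evidence #18
(`HOME/es/GraphPairingDefect.lean`, planner `-es` g3, sha16 6b58086db00a54e3) landed verbatim next to the `c = 0` case
`Theorems/SmallImageMuTransferMuTransferStubX9GraphPairing.lean` (`LevelE.exists_mem_pairingCoeff_ne_zero`, the
polarisation lemma of the `n = 0` core), as the FIRST KERNEL BRICK of the registered stub
`stub_depthX9 : SIM.FineExponentLeEulerLossOnClassX9` for `n ≥ 1` (skeleton of record 089205e1,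
`Cruxes/KatoDivisibilityX9/Lines/graded_euler_loss.lean`): it is step **S3** of the graded-core blueprint
(HOME/MEMO-es.md §15 STEP 1 «Lemma 5.7.B with defect», §21 (A8) «SETTLED on paper … landable by a prover»), the
one step of the port `Ω = Λ/p ↦ A = Λ/(p^{n+1}, ω²)` that is pure algebra; S1 (key formula over `A`), S2
(Chebotarev at `p`-level `n+1`) and S4 (the `X`-side bookkeeping) remain.  It closes no stub and moves no number.

WHERE IT SITS IN THE PORT (MEMO-es §15 STEP 1 / STEP 4): in the graded core theorem the test class is
`p^d Y = ι_*(ȳ)` with `ȳ` of `T`-order only `≥ J − c₀`, so the Goursat module `M = im(h, h^*) ⊂ 𝒯_e ⊕ 𝒯_e^*`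
has FIRST projection onto but SECOND projection equal to a `G`-submodule `T^c 𝒯_e^*` (`c ≤ c₀`), not all of
`𝒯_e^*`: in coordinates every `(x, y) ∈ M` has `y_j = 0` for `j < c`, and slot `c` of the second projection is
onto.  Then the pairing coefficients of index `< c` vanish identically, the coefficient of index `c` is
`ev(y_c, x_0)` and that of index `c + 1` is `ev(y_c, x_1) + ev(y_{c+1}, x_0)`; and `γ − 1 = (T, ι(T))` satisfies
`(Tx)_0 = 0`, `(Tx)_1 = x_0`, `(ι(T)y)_c = 0`, `(ι(T)y)_{c+1} = −y_c` on such `y` (`ι(T) = −T + T² − ⋯`).  The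
landed polarisation proof goes through VERBATIM with the `x`-slots `(0, 1)` and the `y`-slots `(c, c+1)`
decoupled: `ν ≤ c + 1 ≤ c₀ + 1`, which is what §15 STEP 4 consumes (`e ≤ ε_d + a′ + ν`).  No Goursat lemma, no
`End_Ḡ E[p] = 𝔽_p` (so the exceptional image 5S4 is covered by the same argument).

* `exists_mem_coeff_ne_zero_of_polarisation₂` — the landed abstract lemma with the two index pairs decoupled:
  `x`-slots `i₀, i₁`, `y`-slots `j₀, j₁` (same proof, indices renamed).
* `exists_mem_pairingCoeff_ne_zero_of_defect` — the memo's coordinates `Fin e → V`, `Fin e → V'`, defect `c` with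
  `c + 2 ≤ e`.
* `pairingCoeff_eq_of_defect` — the convolution coefficients of index `< c` vanish and those of index `c`, `c + 1`
  are exactly the two terms above, i.e. the disjunction reads `v_T⟨x, y⟩ ≤ c + 1`.

HONEST LABEL: `stub_depthX9` (`n ≥ 1`), `stub_widthX9` and the crux stay OPEN; PARTITION untouched; beyond-print
theorem toward BSD: NO; no summit statement is proved by this seat; BSD is not proved by any of this.

References: HOME(bsd-smallim)/koly/MU-TRANSFER-PROOF.md §4 Lemma 4; HOME(bsd-f3-mu)/MEMO-es.md §15 (S3), §21 (A8);
B. Howard, Compositio 140 (2004) Prop. 3.2.4 [Howard2004HeegnerKolyvagin]; B. Mazur, K. Rubin, Mem. AMS 799 (2004)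
§4.4 [MazurRubin2004].
-/

-- the summit and its single problem are both named `BirchSwinnertonDyer` (registry layout D-0017)
set_option linter.dupNamespace false

set_option autoImplicit false

namespace Summit.BirchSwinnertonDyer.BirchSwinnertonDyer.Rank1Residual.LevelE

variable {k : Type*} [Field k] {V V' : Type*} [AddCommGroup V] [Module k V] [AddCommGroup V']
  [Module k V']

/-- **Polarisation with decoupled slots.** `2 ≠ 0` in `k`, `ev : V' × V → k` bilinear and not
identically zero; `x`-indices `i₀, i₁ : ι`, `y`-indices `j₀, j₁ : ι'`; `M ≤ (ι → V) × (ι' → V')` a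
subspace such that (1) for every `(x, y) ∈ M` some `(x', y') ∈ M` has `x'_{i₀} = 0`, `x'_{i₁} = x_{i₀}`,
`y'_{j₀} = 0`, `y'_{j₁} = −y_{j₀}` (the action of `γ − 1`), (2) the `i₀`-th coordinates of the first
projection exhaust `V` and the `j₀`-th coordinates of the second projection exhaust `V'`. Then some
`(x, y) ∈ M` has `ev(y_{j₀}, x_{i₀}) ≠ 0` or `ev(y_{j₀}, x_{i₁}) + ev(y_{j₁}, x_{i₀}) ≠ 0`. [folklore;
proof = that of `exists_mem_coeff_ne_zero_of_polarisation`] -/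
theorem exists_mem_coeff_ne_zero_of_polarisation₂ (h2 : (2 : k) ≠ 0) {ι ι' : Type*} (i₀ i₁ : ι)
    (j₀ j₁ : ι') (ev : V' →ₗ[k] V →ₗ[k] k) (hev : ∃ (y : V') (v : V), ev y v ≠ 0)
    (M : Submodule k ((ι → V) × (ι' → V')))
    (hγ : ∀ z ∈ M, ∃ z' ∈ M,
      z'.1 i₀ = 0 ∧ z'.1 i₁ = z.1 i₀ ∧ z'.2 j₀ = 0 ∧ z'.2 j₁ = -z.2 j₀)
    (h1 : ∀ v : V, ∃ z ∈ M, z.1 i₀ = v) (h2' : ∀ y : V', ∃ z ∈ M, z.2 j₀ = y) :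
    ∃ z ∈ M, ev (z.2 j₀) (z.1 i₀) ≠ 0 ∨ ev (z.2 j₀) (z.1 i₁) + ev (z.2 j₁) (z.1 i₀) ≠ 0 := by
  by_contra hall
  push Not at hall
  have hP0 : ∀ z ∈ M, ev (z.2 j₀) (z.1 i₀) = 0 := fun z hz => (hall z hz).1
  have hP1 : ∀ z ∈ M, ev (z.2 j₀) (z.1 i₁) + ev (z.2 j₁) (z.1 i₀) = 0 := fun z hz => (hall z hz).2
  -- cross terms on `M × M`
  have hC0 : ∀ z ∈ M, ∀ z' ∈ M, ev (z.2 j₀) (z'.1 i₀) + ev (z'.2 j₀) (z.1 i₀) = 0 := by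
    intro z hz z' hz'
    have h := hP0 (z + z') (M.add_mem hz hz')
    simp only [Prod.fst_add, Prod.snd_add, Pi.add_apply, map_add, LinearMap.add_apply] at h
    rw [hP0 z hz, hP0 z' hz'] at h
    linear_combination h
  have hC1 : ∀ z ∈ M, ∀ z' ∈ M, ev (z.2 j₀) (z'.1 i₁) + ev (z.2 j₁) (z'.1 i₀) +
      (ev (z'.2 j₀) (z.1 i₁) + ev (z'.2 j₁) (z.1 i₀)) = 0 := by
    intro z hz z' hz'
    have h := hP1 (z + z') (M.add_mem hz hz')
    simp only [Prod.fst_add, Prod.snd_add, Pi.add_apply, map_add, LinearMap.add_apply] at h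
    have hz1 := hP1 z hz
    have hz'1 := hP1 z' hz'
    linear_combination h - hz1 - hz'1
  -- evaluate the cross term of the index-`1` coefficient at `(z, (γ - 1) z')`
  have hkey : ∀ z ∈ M, ∀ z' ∈ M, ev (z.2 j₀) (z'.1 i₀) = 0 := by
    intro z hz z' hz'
    obtain ⟨w, hw, hw1, hw2, hw3, hw4⟩ := hγ z' hz'
    have h := hC1 z hz w hw
    rw [hw1, hw2, hw3, hw4] at h
    simp only [map_zero, map_neg, LinearMap.zero_apply, LinearMap.neg_apply, add_zero,
      zero_add] at h
    have h0 := hC0 z hz z' hz'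
    have hsum : (2 : k) * ev (z.2 j₀) (z'.1 i₀) = 0 := by linear_combination h + h0
    rcases mul_eq_zero.mp hsum with h2'' | h'
    · exact absurd h2'' h2
    · exact h'
  obtain ⟨y, v, hyv⟩ := hev
  obtain ⟨z, hz, hzy⟩ := h2' y
  obtain ⟨z', hz', hzv⟩ := h1 v
  have := hkey z hz z' hz'
  rw [hzy, hzv] at this
  exact hyv this

/-- **KOLY Lemma 5.7.B / MU-TRANSFER-PROOF §4 Lemma 4 WITH DEFECT `c` (stub S3 of the graded core
theorem, MEMO-es §15).** Coordinates `Fin e → V` for `𝒯_e`, `Fin e → V'` for `𝒯_e^*` (the `i`-th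
coordinate = coefficient of `T^i`), `c + 2 ≤ e`. `T` and `D = ι(T)` are linear operators with
`(Tx)_0 = 0`, `(Tx)_1 = x_0`, and `(Dy)_c = 0`, `(Dy)_{c+1} = −y_c` for every `y` whose coordinates
below `c` vanish (true for `ι(T) = (1+T)^{-1} − 1 = −T + T² − ⋯`). `M ≤ 𝒯_e × 𝒯_e^*` is a subspace
stable under `(T, D)` (= under `γ − 1`), every `(x, y) ∈ M` has `y_j = 0` for `j < c` (the second
projection lies in `T^c 𝒯_e^*`), the first projection has all of `V` as slot-`0` coordinates and the
second projection has all of `V'` as slot-`c` coordinates (the second projection CONTAINS `T^c 𝒯_e^*`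
as far as slot `c` is concerned). Then some `(x, y) ∈ M` has Gorenstein pairing
`⟨x, y⟩ = Σ_n (Σ_{i+j=n} ev(y_j, x_i)) T^n` of `T`-valuation `≤ c + 1`: since `y_j = 0` for `j < c`,
the coefficient of `T^c` is `ev(y_c, x_0)` and that of `T^{c+1}` is `ev(y_c, x_1) + ev(y_{c+1}, x_0)`,
and one of them is non-zero. At `c = 0` this is the landed `exists_mem_pairingCoeff_ne_zero`. -/
theorem exists_mem_pairingCoeff_ne_zero_of_defect (h2 : (2 : k) ≠ 0) {e c : ℕ} (hce : c + 2 ≤ e)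
    (ev : V' →ₗ[k] V →ₗ[k] k) (hev : ∃ (y : V') (v : V), ev y v ≠ 0)
    (T : (Fin e → V) →ₗ[k] (Fin e → V)) (D : (Fin e → V') →ₗ[k] (Fin e → V'))
    (hT0 : ∀ x, T x ⟨0, by omega⟩ = 0) (hT1 : ∀ x, T x ⟨1, by omega⟩ = x ⟨0, by omega⟩)
    (hD0 : ∀ y : Fin e → V', (∀ j : Fin e, (j : ℕ) < c → y j = 0) → D y ⟨c, by omega⟩ = 0)
    (hD1 : ∀ y : Fin e → V', (∀ j : Fin e, (j : ℕ) < c → y j = 0) →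
      D y ⟨c + 1, by omega⟩ = -y ⟨c, by omega⟩)
    (M : Submodule k ((Fin e → V) × (Fin e → V')))
    (hM : ∀ z ∈ M, (T z.1, D z.2) ∈ M)
    (hMc : ∀ z ∈ M, ∀ j : Fin e, (j : ℕ) < c → z.2 j = 0)
    (h1 : ∀ v : V, ∃ z ∈ M, z.1 ⟨0, by omega⟩ = v)
    (h2' : ∀ y : V', ∃ z ∈ M, z.2 ⟨c, by omega⟩ = y) :
    ∃ z ∈ M, ev (z.2 ⟨c, by omega⟩) (z.1 ⟨0, by omega⟩) ≠ 0 ∨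
      ev (z.2 ⟨c, by omega⟩) (z.1 ⟨1, by omega⟩) +
        ev (z.2 ⟨c + 1, by omega⟩) (z.1 ⟨0, by omega⟩) ≠ 0 :=
  exists_mem_coeff_ne_zero_of_polarisation₂ h2 (⟨0, by omega⟩ : Fin e) ⟨1, by omega⟩
    (⟨c, by omega⟩ : Fin e) ⟨c + 1, by omega⟩ ev hev M
    (fun z hz => ⟨(T z.1, D z.2), hM z hz, hT0 _, hT1 _, hD0 _ (hMc z hz), hD1 _ (hMc z hz)⟩)
    h1 h2'

/-- **The full `T^n`-coefficients below `c + 2`, under the defect hypothesis.** If `y_j = 0` for all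
`j < c`, then the convolution coefficient `Σ_{j ≤ n} ev(y_j, x_{n-j})` vanishes for `n < c`, equals
`ev(y_c, x_0)` for `n = c` and `ev(y_c, x_1) + ev(y_{c+1}, x_0)` for `n = c + 1` — so the disjunction
of `exists_mem_pairingCoeff_ne_zero_of_defect` says exactly `v_T ⟨x, y⟩ ≤ c + 1`. Stated for the
coefficient function `coeff n := Σ_{j : Fin e, j ≤ n} ev (y j) (x (n - j))` with indices read in `ℕ`
(terms with `n - j ≥ e` absent). -/
theorem pairingCoeff_eq_of_defect {e c : ℕ} (hce : c + 2 ≤ e) (ev : V' →ₗ[k] V →ₗ[k] k)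
    (x : Fin e → V) (y : Fin e → V') (hy : ∀ j : Fin e, (j : ℕ) < c → y j = 0)
    (coeff : ℕ → k)
    (hcoeff : ∀ n : ℕ, (hn : n < e) →
      coeff n = ∑ j : Fin (n + 1), ev (y ⟨j, by omega⟩) (x ⟨n - j, by omega⟩)) :
    (∀ n, n < c → coeff n = 0) ∧ coeff c = ev (y ⟨c, by omega⟩) (x ⟨0, by omega⟩) ∧
      coeff (c + 1) = ev (y ⟨c, by omega⟩) (x ⟨1, by omega⟩) +
        ev (y ⟨c + 1, by omega⟩) (x ⟨0, by omega⟩) := by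
  refine ⟨fun n hn => ?_, ?_, ?_⟩
  · rw [hcoeff n (by omega)]
    refine Finset.sum_eq_zero fun j _ => ?_
    rw [hy ⟨j, by omega⟩ (by simp; omega), map_zero, LinearMap.zero_apply]
  · rw [hcoeff c (by omega), Fin.sum_univ_castSucc]
    rw [Finset.sum_eq_zero fun j _ => by
      rw [hy ⟨(Fin.castSucc j : Fin (c + 1)), by simp; omega⟩ (by simp [Fin.is_lt]), map_zero,
        LinearMap.zero_apply]]
    simp
  · rw [hcoeff (c + 1) (by omega), Fin.sum_univ_castSucc, Fin.sum_univ_castSucc]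
    rw [Finset.sum_eq_zero fun j _ => by
      rw [hy ⟨(Fin.castSucc (Fin.castSucc j) : Fin (c + 2)), by simp; omega⟩ (by simp [Fin.is_lt]),
        map_zero, LinearMap.zero_apply]]
    simp

end Summit.BirchSwinnertonDyer.BirchSwinnertonDyer.Rank1Residual.LevelE
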